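import Summits.CriticalPhenomena.SAWScalingLimit.Theorems.FKGToTraversalBound.Negative.R1Split
import Literature.Probability.LatticeModels.PlanarIsingDiscApprox
import HarnessLib

/-!
# The shallow class is strictly larger than the R1 class (stub `exists_isEndpointApprox_shallow_not_bdryApprox`)

Crux `SAWLeftRightFKG.FKGToTraversalBound` (stmt-CriticalPhenomena-1878), line `slit-necklace`, registered stub
`exists_isEndpointApprox_shallow_not_bdryApprox`.  The landed reduction of the line closes (H1) modulo engine and
bubble on {eventually tame domains} × {SHALLOW endpoint approximations: both mesh endpoints eventually at depth
`infDist (δ e_δ) Ωᶜ ≤ K δ`}.  The R1 class `BdryApprox` of `Negative/R1Split` (both endpoints eventually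
lattice-boundary vertices of `Ω_δ`) is contained in the shallow class; here we certify that the inclusion is
STRICT already on the unit disc `DobrushinDomain.unitDisc` (carrier `ball 0 1`, marked points `1, -1`).

**Construction.**  Put the two lattice endpoints TWO ROWS inside the disc on the real axis:
`a δ = (⌈δ⁻¹⌉ - 3, 0)`, `b δ = (-(⌈δ⁻¹⌉ - 3), 0)`.  Since `δ⁻¹ ≤ ⌈δ⁻¹⌉ < δ⁻¹ + 1`, the mesh abscissa
`δ (⌈δ⁻¹⌉ - 3)` lies in `[1 - 3δ, 1 - 2δ)` (`shallow_abscissa_bounds`).  Hence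
* depth: `infDist (δ a_δ) (ball 0 1)ᶜ ≤ dist (δ a_δ) 1 ≤ 3δ` (`dist_shallow_one_le`), so `K = 3`, and the same
  for `b` with the point `-1` by the symmetry `δ (-m, 0) = -δ (m, 0)` (`meshPoint_axis_neg`);
* convergence: `δ a_δ → 1 = pt 0` and `δ b_δ → -1 = pt 1` (`tendsto_shallow`), with rate `3δ`;
* reachability: both mesh points lie in the disc for `δ < 1/3`, and any two mesh vertices of the disc are joined
  in `Ω_δ` (`reachable_of_mem_ball`): the mesh vertex graph of the disc is preconnected and its discrete domain is
  the whole vertex set (`Literature.Probability.LatticeModels.UnitDisc.preconnected`, `UnitDisc.meshDomain_eq`,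
  file `Literature/Probability/LatticeModels/PlanarIsingDiscApprox.lean`), so the inclusion of the vertex graph
  into `Ω_δ` is a graph homomorphism carrying a connecting walk; thus `(a, b)` is an `IsEndpointApprox`;
* NOT lattice-boundary: for `δ < 1/3` the open ball of radius `2δ > δ` about `δ a_δ` lies inside the disc
  (`ball_shallow_subset`: `‖z‖ < 2δ + δ(⌈δ⁻¹⌉ - 3) < 1`), so all four lattice neighbours of `a δ` are mesh
  vertices joined to it by mesh edges (the segment lies in that convex ball), hence in its component of `Ω_δ`:
  `a δ ∉ meshBoundary` (`not_mem_meshBoundary_of_ball_subset_of_lt`, the radius-`r > δ` version of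
  `Negative.not_mem_meshBoundary_of_ball_subset`, which has `r = √δ`).  `BdryApprox` would make `a δ` a boundary
  vertex for all small `δ`; intersecting with `Ioo 0 (1/16) ∈ 𝓝[>] 0` and extracting a witness
  (`(𝓝[>] 0).NeBot`) gives the contradiction.
Template: the depth-`√δ` certificate `TPToTraversalBound.Negative.exists_isEndpointApprox_deepStart`, with the
`√δ`-terms replaced by constants.  No named fact is used; axioms are the standard three.
-/

open MeasureTheory Filter Topology Set Metric
open Literature.Probability.LatticeModels Literature.Probability.RandomPlanarGeometry
  Literature.Probability.RandomPlanarGeometry.SAW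
open Summit.CriticalPhenomena.SAWScalingLimit.Theorems.FKGToTraversalBound.Negative (H1At BdryApprox)

namespace Summit.CriticalPhenomena.SAWScalingLimit.Theorems.FKGToTraversalBound.SlitNecklace

/-! ### Mesh points on the real axis -/

/-- The mesh point of the axis site `(-m, 0)` is minus that of `(m, 0)` (both are real; cf.
`Literature.Barriers.CriticalPhenomena.SupercriticalSAW.meshPoint_axis`, not imported here). [folklore] -/
theorem meshPoint_axis_neg (δ : ℝ) (m : ℤ) : meshPoint δ ![-m, 0] = -meshPoint δ ![m, 0] :=
  Complex.ext (by simp) (by simp)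

/-- A ball about the mesh point of `(-m, 0)` lies in the unit disc as soon as the ball of the same radius about
the mesh point of `(m, 0)` does (symmetry `z ↦ -z` of the disc). [folklore] -/
theorem ball_axis_neg_subset {δ r : ℝ} {m : ℤ} (h : ball (meshPoint δ ![m, 0]) r ⊆ ball (0 : ℂ) 1) :
    ball (meshPoint δ ![-m, 0]) r ⊆ ball (0 : ℂ) 1 := by
  intro z hz
  have hz' : -z ∈ ball (meshPoint δ ![m, 0]) r := by
    rw [Metric.mem_ball, dist_eq_norm] at hz ⊢
    rw [meshPoint_axis_neg, sub_neg_eq_add] at hz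
    rwa [show -z - meshPoint δ ![m, 0] = -(z + meshPoint δ ![m, 0]) by ring, norm_neg]
  have h' := h hz'
  rwa [Metric.mem_ball, dist_zero_right, norm_neg, ← dist_zero_right, ← Metric.mem_ball] at h'

/-! ### The shallow abscissa `⌈δ⁻¹⌉ - 3`: two rows inside the disc -/

/-- The mesh point of the shallow start `(⌈δ⁻¹⌉ - 3, 0)` is the real number `δ (⌈δ⁻¹⌉ - 3)`. [folklore] -/
theorem meshPoint_shallow (δ : ℝ) :
    meshPoint δ ![⌈δ⁻¹⌉ - 3, 0] = ((δ * ((⌈δ⁻¹⌉ - 3 : ℤ) : ℝ) : ℝ) : ℂ) :=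
  Complex.ext (by simp) (by simp)

/-- The mesh abscissa `δ (⌈δ⁻¹⌉ - 3)` lies in `[1 - 3δ, 1 - 2δ)`: from `δ⁻¹ ≤ ⌈δ⁻¹⌉ < δ⁻¹ + 1`. [folklore] -/
theorem shallow_abscissa_bounds {δ : ℝ} (hδ : 0 < δ) :
    1 - 3 * δ ≤ δ * ((⌈δ⁻¹⌉ - 3 : ℤ) : ℝ) ∧ δ * ((⌈δ⁻¹⌉ - 3 : ℤ) : ℝ) < 1 - 2 * δ := by
  have h1 : (δ⁻¹ : ℝ) ≤ ⌈δ⁻¹⌉ := Int.le_ceil _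
  have h2 : (⌈δ⁻¹⌉ : ℝ) < δ⁻¹ + 1 := Int.ceil_lt_add_one _
  have hδinv : δ * δ⁻¹ = 1 := mul_inv_cancel₀ hδ.ne'
  have e1 : 1 ≤ δ * (⌈δ⁻¹⌉ : ℝ) := by
    have := mul_le_mul_of_nonneg_left h1 hδ.le; rwa [hδinv] at this
  have e2 : δ * (⌈δ⁻¹⌉ : ℝ) < 1 + δ := by
    have := mul_lt_mul_of_pos_left h2 hδ; rwa [mul_add, hδinv, mul_one] at this
  have cast : ((⌈δ⁻¹⌉ - 3 : ℤ) : ℝ) = (⌈δ⁻¹⌉ : ℝ) - 3 := by simp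
  rw [cast, mul_sub]
  constructor <;> linarith

/-- **Depth `≤ 3δ`.**  The shallow start `(⌈δ⁻¹⌉ - 3, 0)` is within `3δ` of the marked point `1`:
`dist (δ a_δ) 1 = 1 - δ (⌈δ⁻¹⌉ - 3) ≤ 3δ`. [folklore] -/
theorem dist_shallow_one_le {δ : ℝ} (hδ : 0 < δ) : dist (meshPoint δ ![⌈δ⁻¹⌉ - 3, 0]) 1 ≤ 3 * δ := by
  rw [meshPoint_shallow, ← Complex.ofReal_one, Complex.dist_eq, ← Complex.ofReal_sub, Complex.norm_real,
    Real.norm_eq_abs, abs_le]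
  obtain ⟨h1, h2⟩ := shallow_abscissa_bounds hδ
  constructor <;> linarith

/-- The shallow end `(-(⌈δ⁻¹⌉ - 3), 0)` is within `3δ` of the marked point `-1` (symmetry `z ↦ -z`). [folklore] -/
theorem dist_shallow_neg_one_le {δ : ℝ} (hδ : 0 < δ) :
    dist (meshPoint δ ![-(⌈δ⁻¹⌉ - 3), 0]) (-1) ≤ 3 * δ := by
  rw [meshPoint_axis_neg, dist_neg_neg]
  exact dist_shallow_one_le hδ

/-- **The `2δ`-ball about the shallow start lies in the disc** (`0 < δ < 1/3`): `‖z‖ < 2δ + δ (⌈δ⁻¹⌉ - 3) < 1`.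
[folklore] -/
theorem ball_shallow_subset {δ : ℝ} (hδ : 0 < δ) (hδ' : δ < 1 / 3) :
    ball (meshPoint δ ![⌈δ⁻¹⌉ - 3, 0]) (2 * δ) ⊆ ball (0 : ℂ) 1 := by
  intro z hz
  rw [Metric.mem_ball, dist_zero_right]
  rw [Metric.mem_ball, meshPoint_shallow, dist_eq_norm] at hz
  obtain ⟨h1, h2⟩ := shallow_abscissa_bounds hδ
  have hp : ‖((δ * ((⌈δ⁻¹⌉ - 3 : ℤ) : ℝ) : ℝ) : ℂ)‖ = δ * ((⌈δ⁻¹⌉ - 3 : ℤ) : ℝ) := by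
    rw [Complex.norm_real, Real.norm_eq_abs, abs_of_pos (by linarith)]
  calc ‖z‖ ≤ ‖z - ((δ * ((⌈δ⁻¹⌉ - 3 : ℤ) : ℝ) : ℝ) : ℂ)‖ + ‖((δ * ((⌈δ⁻¹⌉ - 3 : ℤ) : ℝ) : ℝ) : ℂ)‖ :=
        norm_le_norm_sub_add z _
    _ < 2 * δ + δ * ((⌈δ⁻¹⌉ - 3 : ℤ) : ℝ) := by rw [hp]; linarith
    _ < 1 := by linarith

/-- The `2δ`-ball about the shallow end lies in the disc (`0 < δ < 1/3`). [folklore] -/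
theorem ball_shallow_neg_subset {δ : ℝ} (hδ : 0 < δ) (hδ' : δ < 1 / 3) :
    ball (meshPoint δ ![-(⌈δ⁻¹⌉ - 3), 0]) (2 * δ) ⊆ ball (0 : ℂ) 1 :=
  ball_axis_neg_subset (ball_shallow_subset hδ hδ')

/-- For `0 < δ < 1/3` the mesh point of the shallow start lies in the disc. [folklore] -/
theorem meshPoint_shallow_mem {δ : ℝ} (hδ : 0 < δ) (hδ' : δ < 1 / 3) :
    meshPoint δ ![⌈δ⁻¹⌉ - 3, 0] ∈ ball (0 : ℂ) 1 :=
  ball_shallow_subset hδ hδ' (mem_ball_self (by positivity))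

/-- For `0 < δ < 1/3` the mesh point of the shallow end lies in the disc. [folklore] -/
theorem meshPoint_shallow_neg_mem {δ : ℝ} (hδ : 0 < δ) (hδ' : δ < 1 / 3) :
    meshPoint δ ![-(⌈δ⁻¹⌉ - 3), 0] ∈ ball (0 : ℂ) 1 :=
  ball_shallow_neg_subset hδ hδ' (mem_ball_self (by positivity))

/-- **Convergence to the marked point.**  `δ a_δ → 1` as `δ → 0⁺` (rate `3δ`). [folklore] -/
theorem tendsto_shallow : Tendsto (fun δ : ℝ => meshPoint δ ![⌈δ⁻¹⌉ - 3, 0]) (𝓝[>] (0 : ℝ)) (𝓝 1) := by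
  rw [Metric.tendsto_nhds]
  intro ε hε
  filter_upwards [Ioo_mem_nhdsGT (show (0 : ℝ) < ε / 3 by positivity)] with δ hδ
  calc dist (meshPoint δ ![⌈δ⁻¹⌉ - 3, 0]) 1 ≤ 3 * δ := dist_shallow_one_le hδ.1
    _ < ε := by linarith [hδ.2]

/-! ### Interior sites are not lattice-boundary vertices -/

/-- A site whose open `r`-ball, `r > δ > 0`, lies inside `Ω` is NOT a lattice-boundary vertex of `Ω_δ`: every
`ℤ²`-neighbour has its mesh point at distance `δ < r`, so it is a mesh vertex joined to the site by a mesh edge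
(the segment lies in the convex ball, inside `Ω̄`), hence lies in the same component, i.e. in `Ω_δ`
(`Negative.mem_meshDomain_of_adj`).  Radius-`r` version of `Negative.not_mem_meshBoundary_of_ball_subset`.
[folklore] -/
theorem not_mem_meshBoundary_of_ball_subset_of_lt {Ω : Set ℂ} {δ r : ℝ} (hδ : 0 < δ) (hr : δ < r)
    {x : Site 2} (hball : ball (meshPoint δ x) r ⊆ Ω) : x ∉ meshBoundary Ω δ := by
  intro hx
  rw [mem_meshBoundary_iff] at hx
  obtain ⟨hxD, y, hxy, hnadj⟩ := hx
  apply hnadj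
  have hyball : meshPoint δ y ∈ ball (meshPoint δ x) r := by
    rw [Metric.mem_ball, dist_eq_norm]
    calc ‖meshPoint δ y - meshPoint δ x‖
        ≤ |(meshPoint δ y - meshPoint δ x).re| + |(meshPoint δ y - meshPoint δ x).im| :=
          Complex.norm_le_abs_re_add_abs_im _
      _ = δ := (abs_re_im_meshPoint_sub_of_adj hδ.le hxy).2.2
      _ < r := hr
  have hxball : meshPoint δ x ∈ ball (meshPoint δ x) r := mem_ball_self (hδ.trans hr)
  have hseg : segment ℝ (meshPoint δ x) (meshPoint δ y) ⊆ closure Ω :=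
    ((convex_ball _ _).segment_subset hxball hyball).trans (hball.trans subset_closure)
  have hmadj : (meshGraph Ω δ).Adj x y := meshGraph_adj_iff.2 ⟨hxy, hseg⟩
  have hyV : y ∈ meshVertices Ω δ := hball hyball
  exact discreteDomainGraph_adj_iff.2 ⟨hmadj, hxD, Negative.mem_meshDomain_of_adj hxD hyV hmadj⟩

/-- For `0 < δ < 1/3` the shallow start is not a lattice-boundary vertex of the digital unit disc (its `2δ`-ball
is inside the disc and `δ < 2δ`). [folklore] -/
theorem shallow_not_mem_meshBoundary {δ : ℝ} (hδ : 0 < δ) (hδ' : δ < 1 / 3) :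
    (![⌈δ⁻¹⌉ - 3, 0] : Site 2) ∉ meshBoundary (ball (0 : ℂ) 1) δ :=
  not_mem_meshBoundary_of_ball_subset_of_lt hδ (by linarith) (ball_shallow_subset hδ hδ')

/-! ### Connectivity of the digital disc -/

/-- **Any two mesh vertices of the unit disc are joined in `Ω_δ`**: the mesh vertex graph of the disc is
preconnected and the discrete domain is the whole vertex set (`UnitDisc.preconnected`, `UnitDisc.meshDomain_eq`
of `Literature/Probability/LatticeModels/PlanarIsingDiscApprox.lean`), so the inclusion of the vertex graph into
`Ω_δ` is a graph homomorphism carrying a connecting walk. [folklore] -/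
theorem reachable_of_mem_ball {δ : ℝ} {x y : Site 2} (hx : meshPoint δ x ∈ ball (0 : ℂ) 1)
    (hy : meshPoint δ y ∈ ball (0 : ℂ) 1) : (discreteDomainGraph (ball (0 : ℂ) 1) δ).Reachable x y := by
  have hD : ∀ {z : Site 2}, z ∈ meshVertices (ball (0 : ℂ) 1) δ → z ∈ meshDomain (ball (0 : ℂ) 1) δ :=
    fun hz => by rw [UnitDisc.meshDomain_eq]; exact hz
  let hom : meshVertexGraph (ball (0 : ℂ) 1) δ →g discreteDomainGraph (ball (0 : ℂ) 1) δ :=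
    { toFun := Subtype.val
      map_rel' := fun {u v} h => discreteDomainGraph_adj_iff.2 ⟨h, hD u.2, hD v.2⟩ }
  exact (UnitDisc.preconnected δ ⟨x, hx⟩ ⟨y, hy⟩).map hom

/-! ### The registered stub -/

/-- **Registered stub `exists_isEndpointApprox_shallow_not_bdryApprox`** (line `slit-necklace`, crux
stmt-CriticalPhenomena-1878).  The shallow class STRICTLY contains the R1 class on the unit disc: the endpoint
approximation `a δ = (⌈δ⁻¹⌉ - 3, 0)`, `b δ = (-(⌈δ⁻¹⌉ - 3), 0)` of `DobrushinDomain.unitDisc` is an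
`IsEndpointApprox` (reachable inside the digital disc, mesh points `→ ±1`), both endpoints sit at depth `≤ 3δ`
from the complement of the disc (`K = 3`), yet for every `0 < δ < 1/16` the start is not a lattice-boundary vertex
(its `2δ`-ball is inside the disc), so `BdryApprox` fails. [folklore] -/
theorem exists_isEndpointApprox_shallow_not_bdryApprox : ∃ (a b : ℝ → Site 2) (K : ℝ),
    IsEndpointApprox DobrushinDomain.unitDisc a b ∧ ¬ BdryApprox DobrushinDomain.unitDisc a b ∧
      ∀ᶠ δ in 𝓝[>] (0 : ℝ), infDist (meshPoint δ (a δ)) DobrushinDomain.unitDisc.carrierᶜ ≤ K * δ ∧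
        infDist (meshPoint δ (b δ)) DobrushinDomain.unitDisc.carrierᶜ ≤ K * δ := by
  have carrier_eq : DobrushinDomain.unitDisc.carrier = ball (0 : ℂ) 1 := rfl
  -- the marked points of `(𝔻; 1, -1)`
  have pt_zero : DobrushinDomain.unitDisc.pt 0 = 1 := by
    simp [MarkedDomain.pt, DobrushinDomain.unitDisc, JordanDomain.unitDisc, circleMap]
  have pt_one : DobrushinDomain.unitDisc.pt 1 = -1 := by
    have h : DobrushinDomain.unitDisc.pt 1 = circleMap 0 1 (2 * Real.pi * (1 / 2)) := rfl
    rw [h, circleMap]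
    have h2 : ((2 * Real.pi * (1 / 2) : ℝ) : ℂ) * Complex.I = Real.pi * Complex.I := by push_cast; ring
    rw [h2, Complex.exp_pi_mul_I]
    simp
  have small_mem : Ioo (0 : ℝ) (1 / 16) ∈ 𝓝[>] (0 : ℝ) := Ioo_mem_nhdsGT (by norm_num)
  refine ⟨fun δ => ![⌈δ⁻¹⌉ - 3, 0], fun δ => ![-(⌈δ⁻¹⌉ - 3), 0], 3, ⟨?_, ?_, ?_⟩, fun hbd => ?_, ?_⟩
  · -- reachability inside `Ω_δ` for `0 < δ < 1/16`
    filter_upwards [small_mem] with δ hδ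
    rw [carrier_eq]
    exact reachable_of_mem_ball (meshPoint_shallow_mem hδ.1 (by linarith [hδ.2]))
      (meshPoint_shallow_neg_mem hδ.1 (by linarith [hδ.2]))
  · -- `δ a_δ → 1 = pt 0`
    rw [pt_zero]
    exact tendsto_shallow
  · -- `δ b_δ = -δ a_δ → -1 = pt 1`
    rw [pt_one]
    have h : (fun δ : ℝ => meshPoint δ ![-(⌈δ⁻¹⌉ - 3), 0]) = fun δ => -meshPoint δ ![⌈δ⁻¹⌉ - 3, 0] :=
      funext fun δ => meshPoint_axis_neg δ _
    rw [h]
    exact tendsto_shallow.neg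
  · -- not in the R1 class: the start is never a lattice-boundary vertex for `0 < δ < 1/16`
    obtain ⟨δ, ⟨hmb, -⟩, hδ0, hδ1⟩ := (hbd.and small_mem).exists
    rw [carrier_eq] at hmb
    exact shallow_not_mem_meshBoundary hδ0 (by linarith) hmb
  · -- depth `≤ 3δ` at both ends
    have h1 : (1 : ℂ) ∈ (DobrushinDomain.unitDisc.carrier)ᶜ := by
      rw [carrier_eq, mem_compl_iff, Metric.mem_ball, dist_zero_right, norm_one]
      exact lt_irrefl 1
    have h1' : (-1 : ℂ) ∈ (DobrushinDomain.unitDisc.carrier)ᶜ := by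
      rw [carrier_eq, mem_compl_iff, Metric.mem_ball, dist_zero_right, norm_neg, norm_one]
      exact lt_irrefl 1
    filter_upwards [small_mem] with δ hδ
    exact ⟨(infDist_le_dist_of_mem h1).trans (dist_shallow_one_le hδ.1),
      (infDist_le_dist_of_mem h1').trans (dist_shallow_neg_one_le hδ.1)⟩

end Summit.CriticalPhenomena.SAWScalingLimit.Theorems.FKGToTraversalBound.SlitNecklace
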